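import Literature.IUT.HodgeTheaters.Cor53iFcircLiftsAllAtOpenEmbedding
import HarnessLib

/-!
# Layer-5 certificate v0.28 — BLOCK L over BUILT Literature modules only: [IUTchI] Cor 5.3 (i) «respectively `⊚`» AS PRINTED
# («bijective») at the push carrier of EVERY OPEN EMBEDDING `ι : H ↪ G_F` — modulo the NAMED FACT {`NeukirchUchida F`} ONLY:
# SIDE ∅ (the SIDE-EXTRA {`Normal ℚ F`} of BLOCK K removed), carrier data {`hc`, `ho`, `hinj`} displayed
# (abc-iut-L5-lead gen 11 RULINGS #233/#234 «V28 candidate display (C-53i⊚-bij@open-emb, SIDE ∅)»; drafted by abc-iut-L5-t11 gen 22 for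
# the CERT-L5 R73 holder; plan/L5/LAYER5-CERT-SPEC.md §7)

PROOF-ONLY (no `def`, no `instance`, no `axiom`, no `sorry`, no `notation`); NO `Conditional` import (architecture-neutral).  The one
theorem is a landed Literature theorem VERBATIM (section variables spelled in), proof BY NAME — one call, from abc-iut-L5-t11's
row «LIFT⊚@OPEN-EMBEDDING SIDE-FREE»: ★ p562181 `Cor53iFcircLiftsAllAtOpenEmbedding` (the surjectivity half `hlift⊚` proved DIRECTLY —
transport of structure along the Neukirch–Uchida field automorphism `τ` on the whiskered arithmetic model over `ℬ(H)⁰`, no descent to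
`ℬ(G_F)⁰`, hence no normality of `F/ℚ`; injectivity = abc-iut-L5-t4's ★ p545785 `Cor53.fcirc_rigidOverBase_of_pushCarrier`):
* (C-53i⊚-bij@open-emb′) `layer5_disch_cor53i_v28_fcirc_descendBijective_openEmbedding_sideFree (F) (hNU) (H) (ι) (hc) (ho) (hinj) (𝓕)`
  := `Cor53.fcirc_descendBijective_of_openEmbedding_of_neukirchUchida_sideFree`: for EVERY profinite `H`, EVERY continuous open
  injective `ι : H →* G_F` (the class of print's `π₁(†𝒟^⊚) ↪ π₁(†𝒟^⊛)`, [IUTchI] Ex 5.1 (i)) and EVERY record `𝓕` over the push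
  carrier `ℬ(H)⁰ → CosetCat H → CosetCat G_F → ℬ(G_F)⁰`, the §0 map `Aut(†ℱ^⊚) → Aut(†𝒟^⊚)` is BIJECTIVE — DISPLAYED binders exactly
  {`hNU : NeukirchUchida F`} (FACT, BY NAME: [NSW] Thm (12.2.1)) + carrier data {`hc`, `ho`, `hinj`}; SIDE ∅; LAW ∅ (`hZ` from `G_F`
  slim + `ι` injective open; `hlift⊚`, `hS`, `hB⊚` all discharged inside the Literature files).
This conjunct SUPERSEDES BLOCK K's (C-53i⊚-bij@open-emb) in READING (K stays a true display: its SIDE-EXTRA {`Normal ℚ F`} is the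
hypothesis of the DESCENT route `hdesc⊚ ⟺ AutCompatible ι`, ★ p558767 / ★ p559943, not of the printed bijectivity at this carrier).
CENSUS delta for §7 (the lead's booking): display: +1 conjunct with binder set {hNU} ∪ data {hc, ho, hinj}; SIDE-EXTRA register
−{Normal ℚ F} in reading; FACT column unchanged (hNU counted via (C-53i⊛) at v0.23); tokens none.
S. Mochizuki, *Inter-universal Teichmüller theory I* [cite: Mochizuki2012] (D-0012 claim key; series status DISPUTED): Cor 5.3 (i) p. 144;
Ex 5.1 (i)/(iii)/(v) pp. 123–128.  HONEST FRAMING: a CERT conjunct DISPLAYS its binders, it does not discharge them; `NeukirchUchida F`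
is a NAMED FACT, unproved in the tree; OUR stand-in carrier and OUR lift route; nothing here asserts that abc is proved or refuted or
takes a side on [IUTchIII] Cor. 3.12; typed ≠ inhabited ≠ discharged; indexed ≠ endorsed.
-/

namespace Summit.ABC.IUTFork.Conditional

open CategoryTheory Opposite Function Literature.IUT.HodgeTheaters
open Literature.AnabelianGeometry.SemiGraphs Literature.AlgebraicGeometry.Frobenioids
open Literature.AlgebraicGeometry.Frobenioids.QuasiTemperoid Literature.NumberTheory.GaloisRepresentations

noncomputable section BlocksLV28

/-- **(C-53i⊚-bij@open-emb′) [IUTchI] Cor 5.3 (i) «resp. `⊚`» AS PRINTED («bijective») at the push carrier of EVERY open embedding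
`ι : H ↪ G_F`, for EVERY record, modulo {`NeukirchUchida F`} ONLY — SIDE ∅** := abc-iut-L5-t11's ★
`Cor53.fcirc_descendBijective_of_openEmbedding_of_neukirchUchida_sideFree` (p562181).  DISPLAYED binders exactly {`hNU`} (FACT) +
carrier data {`hc`, `ho`, `hinj`}; LAW ∅; no `Normal ℚ F`.
[cite: Mochizuki2012, IUTchI Cor 5.3 (i) p.144] [claim: Mochizuki2012, status: disputed] -/
theorem layer5_disch_cor53i_v28_fcirc_descendBijective_openEmbedding_sideFree (F : Type) [Field F] [NumberField F]
    (hNU : NeukirchUchida F) (H : ProfiniteGrp.{0}) (ι : H →* GalFbar F) (hc : Continuous ι) (ho : IsOpenMap ι) (hinj : Injective ι)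
    (𝓕 : GlobalFrobenioid (GlobalDivisorData.arith F) (BaseCat H)
      (baseToCoset H ⋙ CosetCat.push ι ho ⋙ cosetToBase (absGalGrp F))) :
    CatIsomorphism.DescendBijective 𝓕.fcircBase 𝓕.fcircBase
      (GlobalFrobenioid.hasUnder_and_underUnique_fcircBase_arith_baseCat 𝓕 𝓕
        (isSlimGroup_of_injective_of_isOpenMap ι ho hinj (isSlimGroup_absGalGrp F))
        (isSlimGroup_of_injective_of_isOpenMap ι ho hinj (isSlimGroup_absGalGrp F))).1
      (GlobalFrobenioid.hasUnder_and_underUnique_fcircBase_arith_baseCat 𝓕 𝓕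
        (isSlimGroup_of_injective_of_isOpenMap ι ho hinj (isSlimGroup_absGalGrp F))
        (isSlimGroup_of_injective_of_isOpenMap ι ho hinj (isSlimGroup_absGalGrp F))).2 :=
  Cor53.fcirc_descendBijective_of_openEmbedding_of_neukirchUchida_sideFree F hNU H ι hc ho hinj 𝓕

end BlocksLV28

end Summit.ABC.IUTFork.Conditional

/-! ### Build-lane export guard (ops-buildfix bf1-g30, 2026-08-28; G11b-3 recipe v2 as in `GelbartRogawski1991/UnitaryDualPairSeesawCharacter`):
the theorems of this file carry very large dependent telescopes; at `.olean` export Lean 4.32's library-suggestion indexers fold over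
every local theorem statement and do not finish within the build lane's one-hour clock (measured on a farm node: `lean -o` > 1 500 s, plain
elaboration ≈ 20 s). ONE file-final `local` `[implicit_reducible]` keeps them out of that premise index (inert for Meta and the kernel on
theorems; no definition is tagged; statements and proofs unchanged). -/
set_option allowUnsafeReducibility true in
attribute [local implicit_reducible]
  _root_.Summit.ABC.IUTFork.Conditional.layer5_disch_cor53i_v28_fcirc_descendBijective_openEmbedding_sideFree
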